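import Literature.Analysis.PDE.FlatUniformBounds
import Literature.Analysis.PDE.SlabCoefficientBounds
import HarnessLib

/-!
# The flat fine parametrix: energy bounds of the adapted data, uniformly in the family
# (topic `Analysis/PDE`)

Layer (I') of the programme to prove short-time existence for quasilinear strictly parabolic
systems on a closed manifold (hypothesis `hQL` of
`Literature.Geometry.Riemannian.ricciFlow_shortTime_existence_of_quasilinear`). The number `N`
of Neumann steps of the flat parametrix is chosen from the tolerance BEFORE the patch family
(whose region must contain the support of the `N`-th error); this requires a bound of the initial
quantity `Σ_i ∫ e^{-2λs} E_k(Θ̃_i(s)) ds` that does not depend on the family. This file proves it: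

* `dataAd_eq_zero_of_far` — patches far from the support of the data carry no data;
* `sobolevEnergy_dataAd_le` — `E_k(Θ̃_i(s)) ≤ C_d E_k(Θ(s))`, `C_d` depending only on the frame
  bounds, the profile bounds and `k ≤ K`;
* `sum_lintegral_dataAd_le` — `Σ_i ∫_{(0,t)} e^{-2λs} E_k(Θ̃_i(s)) ≤ m_act C_d T C_Θ` with the number
  of active patches `m_act ≤ (2(ϱ + 2r)/mesh + 1)ⁿ`.

Everything is proved; no named fact and no `sorry` is introduced.

## References

* L. Hörmander, *The Analysis of Linear Partial Differential Operators III*, Springer 1985,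
  §17.1. [Hormander1985III]
-/

noncomputable section

open Set Function Filter Topology Metric MeasureTheory InnerProductSpace
open scoped ContDiff Topology ENNReal RealInnerProductSpace

namespace Literature.Analysis.PDE

open Literature.Analysis.FunctionSpaces Literature.Analysis.FluidPDE TopologicalSpace

variable {E' : Type*} [NormedAddCommGroup E'] [InnerProductSpace ℝ E'] [FiniteDimensional ℝ E']
  [MeasurableSpace E'] [BorelSpace E']
variable {F' : Type*} [NormedAddCommGroup F'] [InnerProductSpace ℝ F'] [FiniteDimensional ℝ F']

namespace FlatStep

variable {ι : Type*} [Fintype ι] {Q : FlatPatches E' ι} {A : ι → E' ≃L[ℝ] E'} {T : ℝ} {Θ : ℝ → E' → F'}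

omit [FiniteDimensional ℝ E'] [MeasurableSpace E'] [BorelSpace E'] [FiniteDimensional ℝ F'] in
/-- **Far patches carry no data**: if `Θ(s)` is supported in `closedBall 0 ϱ` and
`ϱ + 2r < ‖c_i‖` then `Θ̃_i(s) = 0`. [folklore] -/
theorem dataAd_eq_zero_of_far {ϱ : ℝ} (hΘϱ : ∀ s y, Θ s y ≠ 0 → y ∈ closedBall (0 : E') ϱ) (i : ι)
    (hi : ϱ + 2 * Q.r < ‖Q.c i‖) (s : ℝ) : dataAd Q A Θ i s = fun _ ↦ 0 := by
  funext z
  rw [dataAd]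
  by_cases hΘ : Θ s (psi Q A i z) = 0
  · rw [hΘ, smul_zero]
  · have hy : ‖psi Q A i z‖ ≤ ϱ := by simpa [dist_zero_right] using hΘϱ s _ hΘ
    have hρ : Q.ρ i (psi Q A i z) = 0 := by
      by_contra h
      have hm : psi Q A i z ∈ ball (Q.c i) (2 * Q.r) := Q.tsupport_ρ i (subset_tsupport _ h)
      rw [mem_ball, dist_eq_norm] at hm
      have := norm_le_norm_add_norm_sub' (Q.c i) (psi Q A i z)
      rw [norm_sub_rev] at this
      linarith
    rw [hρ, zero_smul]

end FlatStep

/-- **Energy of the adapted data in terms of the energy of the data**, with a constant depending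
only on `k ≤ K`, the frame bounds `a₁, a₂` and the profile bound `M_ρ` (not on the family): for
every family `Q` whose partition functions are translates of a profile `ρ₀` with `|ρ₀| ≤ M_ρ` and
frame words of length `≤ K` bounded by `M_ρ`, frames with `‖A_i‖ ≤ a₁`, `‖A_i⁻¹‖ ≤ a₂`, and every
smooth `Θ`, `E_k(ρ̃_i • Θ∘Ψ_i) ≤ C_d E_k(Θ)`. [cite: Hormander1985III, §17.1] -/
theorem sobolevEnergy_dataAd_le (K : ℕ) {a₁ a₂ Mρ : ℝ} (k : ℕ) (hk : k ≤ K) :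
    ∃ Cd : ℝ≥0∞, Cd ≠ ⊤ ∧ ∀ {ι : Type*} [Fintype ι] (Q : FlatPatches E' ι) (A : ι → E' ≃L[ℝ] E'),
      (∀ i, ‖(A i : E' →L[ℝ] E')‖ ≤ a₁) → (∀ i, ‖((A i).symm : E' →L[ℝ] E')‖ ≤ a₂) →
      ∀ {ρ₀ : E' → ℝ}, ContDiff ℝ ∞ ρ₀ → (∀ i x, Q.ρ i x = ρ₀ (x - Q.c i)) → (∀ x, |ρ₀ x| ≤ Mρ) →
      (∀ lst : List (Fin (Module.finrank ℝ E')), lst ≠ [] → lst.length ≤ K →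
        ∀ x, ‖iterDirDeriv (lst.map (stdOrthonormalBasis ℝ E')) ρ₀ x‖ ≤ Mρ) →
      ∀ {Θs : E' → F'}, ContDiff ℝ ∞ Θs → ∀ i,
        sobolevEnergy k (fun z ↦ Q.ρ i (FlatStep.psi Q A i z) • Θs (FlatStep.psi Q A i z)) ≤ Cd * sobolevEnergy k Θs := by
  obtain ⟨C, hCtop, hC⟩ := sobolevEnergy_smul_le_crude (E := E') (F := F') k
  refine ⟨ENNReal.ofReal (max 1 (a₂ ^ 2) ^ K * ((Module.finrank ℝ E').factorial * a₁ ^ Module.finrank ℝ E')) *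
    (C * ENNReal.ofReal (Mρ ^ 2)), ENNReal.mul_ne_top ENNReal.ofReal_ne_top (ENNReal.mul_ne_top hCtop ENNReal.ofReal_ne_top), ?_⟩
  intro ι _ Q A ha₁ ha₂ ρ₀ hρ₀ hQρ hMρ0 hMρw Θs hΘs i
  -- `Θ̃_i = g ∘ Ψ_i` with `g = ρ_i • Θ`
  have hg : ContDiff ℝ ∞ fun y ↦ Q.ρ i y • Θs y := (Q.ρ_smooth i).smul hΘs
  have hdet : LinearMap.det (((A i).symm : E' →L[ℝ] E') : E' →ₗ[ℝ] E') ≠ 0 :=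
    (A i).symm.toLinearEquiv.isUnit_det'.ne_zero
  have h1 := sobolevEnergy_comp_affine_le ((A i).symm : E' →L[ℝ] E') hdet (Q.c i) k hg
  have heq : (fun z ↦ Q.ρ i (FlatStep.psi Q A i z) • Θs (FlatStep.psi Q A i z)) =
      fun z ↦ (fun y ↦ Q.ρ i y • Θs y) (((A i).symm : E' →L[ℝ] E') z + Q.c i) := rfl
  rw [heq]
  refine h1.trans ?_
  -- the transport constant
  have htr : ENNReal.ofReal (max 1 (‖((A i).symm : E' →L[ℝ] E')‖ ^ 2) ^ k *
      |(LinearMap.det (((A i).symm : E' →L[ℝ] E') : E' →ₗ[ℝ] E'))⁻¹|) ≤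
      ENNReal.ofReal (max 1 (a₂ ^ 2) ^ K * ((Module.finrank ℝ E').factorial * a₁ ^ Module.finrank ℝ E')) := by
    refine ENNReal.ofReal_le_ofReal (mul_le_mul ?_ ?_ (abs_nonneg _) (pow_nonneg (by positivity) _))
    · exact (pow_le_pow_left₀ (by positivity) (max_le_max le_rfl (pow_le_pow_left₀ (norm_nonneg _) (ha₂ i) 2)) k).trans
        (pow_le_pow_right₀ (le_max_left _ _) hk)
    · have hd : (LinearMap.det (((A i).symm : E' →L[ℝ] E') : E' →ₗ[ℝ] E'))⁻¹ =
          LinearMap.det ((A i : E' →L[ℝ] E') : E' →ₗ[ℝ] E') := by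
        rw [show LinearMap.det (((A i).symm : E' →L[ℝ] E') : E' →ₗ[ℝ] E') = ((A i).symm : E' →L[ℝ] E').det from rfl,
          (A i).det_coe_symm, inv_inv]
      rw [hd]
      exact (abs_det_le_factorial_mul_norm_pow _).trans
        (mul_le_mul_of_nonneg_left (pow_le_pow_left₀ (norm_nonneg _) (ha₁ i) _) (Nat.cast_nonneg _))
  -- the Leibniz constant: words of `ρ_i` are translated words of `ρ₀`
  have hρi : ∀ lst : List (Fin (Module.finrank ℝ E')), lst ≠ [] → lst.length ≤ k →
      ∀ x, ‖iterDirDeriv (lst.map (stdOrthonormalBasis ℝ E')) (Q.ρ i) x‖ ≤ Mρ := by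
    intro lst hl hlen x
    have hfun : Q.ρ i = fun y ↦ ρ₀ ((1 : E' →L[ℝ] E') y + -Q.c i) := by
      funext y; rw [hQρ, sub_eq_add_neg]; rfl
    rw [hfun, iterDirDeriv_comp_affine (1 : E' →L[ℝ] E') (-Q.c i) hρ₀]
    have hmap : (lst.map (stdOrthonormalBasis ℝ E')).map (1 : E' →L[ℝ] E') = lst.map (stdOrthonormalBasis ℝ E') := by
      rw [List.map_map]; rfl
    simp only [hmap]
    exact hMρw lst hl (hlen.trans hk) _
  have h2 := hC (Q.ρ_smooth i) hΘs (M := Mρ) (fun x ↦ by rw [hQρ]; exact hMρ0 _) hρi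
  calc _ ≤ ENNReal.ofReal (max 1 (‖((A i).symm : E' →L[ℝ] E')‖ ^ 2) ^ k *
        |(LinearMap.det (((A i).symm : E' →L[ℝ] E') : E' →ₗ[ℝ] E'))⁻¹|) * (C * ENNReal.ofReal (Mρ ^ 2) * sobolevEnergy k Θs) :=
        mul_le_mul' le_rfl h2
    _ ≤ _ := by
        rw [← mul_assoc]
        exact mul_le_mul' (mul_le_mul' htr le_rfl) le_rfl

namespace FlatStep

variable {ι : Type*} [Fintype ι] {Q : FlatPatches E' ι} {A : ι → E' ≃L[ℝ] E'} {T : ℝ} {Θ : ℝ → E' → F'}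


omit [FiniteDimensional ℝ F'] in
/-- **The initial quantity of the contraction, bounded independently of the family**:
`Σ_i ∫_{(0,t)} e^{-2λs} E_k(Θ̃_i(s)) ds ≤ (2(ϱ + 2r)/mesh + 1)ⁿ C_d T C_Θ` when `E_k(Θ̃_i(s)) ≤ C_d E_k(Θ(s))`
for all `i, s`, `E_k(Θ(s)) ≤ C_Θ` on `[0, T]`, and `Θ(s)` is supported in `closedBall 0 ϱ`.
[cite: Hormander1985III, §17.1] -/
theorem sum_lintegral_dataAd_le [DecidableEq ι] {ϱ : ℝ} (hϱ : 0 ≤ ϱ)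
    (hΘϱ : ∀ s y, Θ s y ≠ 0 → y ∈ closedBall (0 : E') ϱ) (k : ℕ) {Cd CΘ : ℝ≥0∞}
    (hCd : ∀ i, ∀ s ∈ Icc 0 T, sobolevEnergy k (dataAd Q A Θ i s) ≤ Cd * sobolevEnergy k (Θ s))
    (hCΘ : ∀ s ∈ Icc 0 T, sobolevEnergy k (Θ s) ≤ CΘ) {lam : ℝ} (hlam : 0 ≤ lam) {t : ℝ} (ht : t ∈ Icc 0 T) :
    ∑ i, (∫⁻ s in Ioo 0 t, (fun (lam s : ℝ) ↦ ENNReal.ofReal (Real.exp (-2 * lam * s))) lam s * sobolevEnergy k (dataAd Q A Θ i s)) ≤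
      ENNReal.ofReal ((2 * (ϱ + 2 * Q.r) / Q.mesh + 1) ^ Module.finrank ℝ E') * (Cd * CΘ * ENNReal.ofReal T) := by
  classical
  -- active patches
  set act : Finset ι := Finset.univ.filter fun i ↦ ‖Q.c i‖ ≤ ϱ + 2 * Q.r with hact
  have hzero : ∀ i ∉ act, ∀ s, sobolevEnergy k (dataAd Q A Θ i s) = 0 := by
    intro i hi s
    have hfar : ϱ + 2 * Q.r < ‖Q.c i‖ := by
      by_contra h; exact hi (Finset.mem_filter.2 ⟨Finset.mem_univ _, not_lt.1 h⟩)
    rw [dataAd_eq_zero_of_far hΘϱ i hfar s]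
    exact sobolevEnergy_zero_fun k
  have hsplit : ∑ i, (∫⁻ s in Ioo 0 t, (fun (lam s : ℝ) ↦ ENNReal.ofReal (Real.exp (-2 * lam * s))) lam s * sobolevEnergy k (dataAd Q A Θ i s)) =
      ∑ i ∈ act, (∫⁻ s in Ioo 0 t, (fun (lam s : ℝ) ↦ ENNReal.ofReal (Real.exp (-2 * lam * s))) lam s * sobolevEnergy k (dataAd Q A Θ i s)) := by
    refine (Finset.sum_subset (Finset.subset_univ act) fun i _ hi ↦ ?_).symm
    simp [hzero i hi]
  rw [hsplit]
  -- each active term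
  have hterm : ∀ i, (∫⁻ s in Ioo 0 t, (fun (lam s : ℝ) ↦ ENNReal.ofReal (Real.exp (-2 * lam * s))) lam s * sobolevEnergy k (dataAd Q A Θ i s)) ≤ Cd * CΘ * ENNReal.ofReal T := by
    intro i
    calc (∫⁻ s in Ioo 0 t, (fun (lam s : ℝ) ↦ ENNReal.ofReal (Real.exp (-2 * lam * s))) lam s * sobolevEnergy k (dataAd Q A Θ i s)) ≤ ∫⁻ _s in Ioo 0 t, Cd * CΘ := by
          refine setLIntegral_mono' measurableSet_Ioo fun s hs ↦ ?_
          have hs' : s ∈ Icc 0 T := ⟨hs.1.le, hs.2.le.trans ht.2⟩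
          have hw : ENNReal.ofReal (Real.exp (-2 * lam * s)) ≤ 1 := by
            rw [← ENNReal.ofReal_one]
            exact ENNReal.ofReal_le_ofReal (Real.exp_le_one_iff.2 (by nlinarith [hs.1.le]))
          calc ENNReal.ofReal (Real.exp (-2 * lam * s)) * sobolevEnergy k (dataAd Q A Θ i s)
              ≤ 1 * (Cd * CΘ) := mul_le_mul' hw ((hCd i s hs').trans (mul_le_mul' le_rfl (hCΘ s hs')))
            _ = Cd * CΘ := one_mul _
      _ = Cd * CΘ * volume (Ioo (0 : ℝ) t) := setLIntegral_const _ _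
      _ ≤ Cd * CΘ * ENNReal.ofReal T := by
          rw [Real.volume_Ioo]
          exact mul_le_mul' le_rfl (ENNReal.ofReal_le_ofReal (by linarith [ht.2]))
  -- count
  have hcard : (act.card : ℝ) ≤ (2 * (ϱ + 2 * Q.r) / Q.mesh + 1) ^ Module.finrank ℝ E' := by
    refine Q.card_le 0 (ϱ + 2 * Q.r) (by linarith [Q.r_pos]) act fun i hi ↦ ?_
    rw [dist_zero_left]  -- `dist 0 (c i) = ‖c i‖`
    exact (Finset.mem_filter.1 hi).2
  calc ∑ i ∈ act, (∫⁻ s in Ioo 0 t, (fun (lam s : ℝ) ↦ ENNReal.ofReal (Real.exp (-2 * lam * s))) lam s * sobolevEnergy k (dataAd Q A Θ i s))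
      ≤ ∑ _i ∈ act, Cd * CΘ * ENNReal.ofReal T := Finset.sum_le_sum fun i _ ↦ hterm i
    _ = (act.card : ℝ≥0∞) * (Cd * CΘ * ENNReal.ofReal T) := by rw [Finset.sum_const, nsmul_eq_mul]
    _ ≤ _ := by
        refine mul_le_mul' ?_ le_rfl
        rw [← ENNReal.ofReal_natCast]
        exact ENNReal.ofReal_le_ofReal hcard

end FlatStep

end Literature.Analysis.PDE

end
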